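import Summits.Parity.GeneralizedHardyLittlewood.Theorems.ChenParityOracleBLAPHostParityFromBrickVaughanTypeI
import Summits.Parity.GeneralizedHardyLittlewood.Theorems.ChenParityOracleBLAPHostParityFromBrickVaughanTypeII
import Summits.Parity.GeneralizedHardyLittlewood.Theorems.ChenParityOracleBLAPHostParityFromBrickVaughanSmall
import HarnessLib

/-!
# Route `ChenParityOracleBLAP` — crux S1 = `HostParityFromBrick` (stmt-Parity-20045): the prime host at one height (static form)

Support file for the prime half `K1 → K2 → HP1` of S1 (step (F2)).  For fixed `x` and a height
`y ≤ x` with `U² ≤ y`, the level sums `∑_{d ∈ Dset} |∑_{k ≤ y} Λ(k) [d ∣ k+2] λ(k+2)|` are bounded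
by combining Vaughan's identity on the `(N−1)#`-rough part (`sum_vonMangoldt_mul_eq_four`), the
Type-I pieces (`sum_abs_T1_le`, `sum_abs_T2a_le`, from the sifted Type-I bound `HTI`), the Type-II
pieces (`sum_abs_T2b_le`, `sum_abs_T3_le`, from the hyperbolic Type-II bound `HTII`), the piece
`Λ_{≤U}` and the non-rough prime powers (`sum_abs_T0_le`, `sum_abs_nonrough_le`)
(`level_vonMangoldt_static`).

References: R. C. Vaughan, Acta Arith. 37 (1980) [Vaughan1980]; H. Iwaniec, E. Kowalski,
*Analytic Number Theory* (2004), §13.4 [IwaniecKowalski2004].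
-/

namespace Summit.Parity.GeneralizedHardyLittlewood.Theorems

open Finset Real
open ArithmeticFunction
open scoped ArithmeticFunction.Moebius
open Literature.NumberTheory.Sieve.Vaughan (cU gU fU)

/-- **The prime host at one height (static form).**  See the module docstring; `L = log x`. -/
theorem level_vonMangoldt_static {x y U N : ℕ} (hx : (16 : ℝ) ≤ x) (hyx : y ≤ x) (hU : 1 ≤ U)
    (hUU : U * U ≤ y) {ρ δ : ℝ} (hUlo : ρ * ((x : ℝ) ^ (1 / 3 - δ) + 1) ≤ U)
    (hUhi : 2 * ((U * U : ℕ) : ℝ) ≤ (x : ℝ) ^ (2 / 3 : ℝ))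
    (hShi : 2 * ((max U (Nat.sqrt y) : ℕ) : ℝ) ≤ (x : ℝ) ^ (2 / 3 : ℝ))
    (hN : Real.exp (Real.log x / Real.log (Real.log x)) ≤ N) (Dset : Finset ℕ) {X₁ X₂ : ℝ}
    (hX₂ : 0 ≤ X₂)
    (HTI : ∀ u : ℕ, u ≤ x → ∀ cb : ℕ → ℝ, (∀ b, |cb b| ≤ 1) →
      (∀ b, cb b ≠ 0 → Nat.Coprime b (primorial (N - 1))) →
      ∑ d ∈ Dset, |∑ b ∈ Icc 1 U, cb b *
        ∑ t ∈ (Icc 1 (u / b)).filter (fun t => Nat.Coprime t (primorial (N - 1))),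
          (if d ∣ b * t + 2 then (liouville (b * t + 2) : ℝ) else 0)| ≤ X₁)
    (HTII : ∀ M V₀ : ℕ, ρ * ((x : ℝ) ^ (1 / 3 - δ) + 1) ≤ M → 2 * (M : ℝ) ≤ (x : ℝ) ^ (2 / 3 : ℝ) →
      ∀ α β : ℕ → ℝ, (∀ n, |α n| ≤ 1) → (∀ n, |β n| ≤ 1) →
      (∀ n, α n ≠ 0 → ∀ p ∈ n.primeFactors, Real.exp (Real.log x / Real.log (Real.log x)) ≤ (p : ℝ)) →
      (∀ n, β n ≠ 0 → ∀ p ∈ n.primeFactors, Real.exp (Real.log x / Real.log (Real.log x)) ≤ (p : ℝ)) →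
      ∑ d ∈ Dset, |∑ m ∈ Ioc M (2 * M), ∑ n ∈ Ioc V₀ (y / m),
        α m * β n * (if d ∣ m * n + 2 then (liouville (m * n + 2) : ℝ) else 0)| ≤ X₂) :
    ∑ d ∈ Dset, |∑ k ∈ Icc 1 y, vonMangoldt k *
        (if d ∣ k + 2 then (liouville (k + 2) : ℝ) else 0)| ≤
      #Dset * (6 * U + (N : ℝ) * (Nat.log 2 y + 1 : ℕ) * Real.log y) +
        4 * Real.log x * X₁ +
        ((Nat.log 2 (U * U) + 1 : ℕ) : ℝ) * (Real.log x * X₂) +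
        2 * ((Nat.log 2 x + 1 : ℕ) : ℝ) * (Real.log x ^ 2 * X₂) := by
  classical
  set P : ℕ := primorial (N - 1) with hPdef
  have hx2 : 2 ≤ x := by exact_mod_cast (show (2 : ℝ) ≤ x by linarith)
  have hUy : U ≤ y := le_trans (Nat.le_mul_of_pos_right U hU) hUU
  have hUx : U ≤ x := hUy.trans hyx
  have hUUx : U * U ≤ x := hUU.trans hyx
  set f : ℕ → ℕ → ℝ := fun d k => if d ∣ k + 2 then (liouville (k + 2) : ℝ) else 0 with hf
  set ind : ℕ → ℝ := fun k => if Nat.Coprime k P then (1 : ℝ) else 0 with hind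
  set h : ℕ → ℕ → ℝ := fun d k => ind k * f d k with hh
  -- split rough / non-rough
  have hsplit0 : ∀ d, ∑ k ∈ Icc 1 y, vonMangoldt k * f d k =
      ∑ k ∈ Ioc 0 y, vonMangoldt k * h d k +
      ∑ k ∈ Ioc 0 y, vonMangoldt k * ((1 - ind k) * f d k) := by
    intro d
    have hIcc : Icc 1 y = Ioc 0 y := by ext k; simp only [Finset.mem_Icc, Finset.mem_Ioc]; omega
    rw [hIcc, ← Finset.sum_add_distrib]
    refine Finset.sum_congr rfl fun k _ => ?_
    simp only [hh]; ring
  -- Vaughan on the rough part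
  have hV : ∀ d, ∑ k ∈ Ioc 0 y, vonMangoldt k * h d k =
      ∑ k ∈ Ioc 0 U, vonMangoldt k * h d k +
      ∑ b ∈ Ioc 0 U, (μ b : ℝ) * ∑ t ∈ Ioc 0 (y / b), Real.log t * h d (b * t) -
      ∑ b ∈ Ioc 0 (U * U), cU U b * ∑ t ∈ Ioc 0 (y / b), h d (b * t) +
      ∑ m ∈ Ioc 0 y, gU U m * ∑ n ∈ Ioc 0 (y / m), fU U n * h d (m * n) :=
    fun d => sum_vonMangoldt_mul_eq_four hU hUU (h d)
  have hIoc : Ioc 0 U = Icc 1 U := by ext k; simp only [Finset.mem_Icc, Finset.mem_Ioc]; omega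
  -- T2 split
  have hT2split : ∀ d, ∑ b ∈ Ioc 0 (U * U), cU U b * ∑ t ∈ Ioc 0 (y / b), h d (b * t) =
      ∑ b ∈ Icc 1 U, cU U b * ∑ t ∈ Ioc 0 (y / b), h d (b * t) +
      ∑ b ∈ Ioc U (U * U), cU U b * ∑ t ∈ Ioc 0 (y / b), h d (b * t) := by
    intro d
    rw [← hIoc, Finset.sum_Ioc_consecutive _ (Nat.zero_le U) (Nat.le_mul_of_pos_right U hU)]
  -- T3 rewrite
  have hT3 : ∀ d, ∑ m ∈ Ioc 0 y, gU U m * ∑ n ∈ Ioc 0 (y / m), fU U n * h d (m * n) =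
      ∑ m ∈ Ioc U y, gU U m * ∑ n ∈ Ioc U (y / m), vonMangoldt n * h d (m * n) := by
    intro d
    rw [sum_gU_mul_eq hUy]
    refine Finset.sum_congr rfl fun m _ => ?_
    rw [sum_fU_mul_eq]
  -- the five bounds
  have hB0 := sum_abs_T0_le Dset U ind (fun k => by simp only [hind]; split_ifs <;> simp)
  have hB1 := sum_abs_T1_le (P := P) hx2 hyx hUx Dset HTI
  have hB2a := sum_abs_T2a_le (U := U) (P := P) hx2 hyx hUx Dset HTI
  have hB2b := sum_abs_T2b_le (y := y) hPdef hN hx2 hU hUUx hUlo hUhi Dset hX₂ HTII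
  have hB3 := sum_abs_T3_le hPdef hN hx hyx hU hUy hUlo hShi hN Dset hX₂ HTII
  have hBNR := sum_abs_nonrough_le Dset N y
  -- combine per `d`
  have hperd : ∀ d ∈ Dset, |∑ k ∈ Icc 1 y, vonMangoldt k * f d k| ≤
      |∑ k ∈ Ioc 0 U, vonMangoldt k * h d k| +
      |∑ b ∈ Icc 1 U, (μ b : ℝ) * ∑ t ∈ Ioc 0 (y / b), Real.log t * h d (b * t)| +
      |∑ b ∈ Icc 1 U, cU U b * ∑ t ∈ Ioc 0 (y / b), h d (b * t)| +
      |∑ b ∈ Ioc U (U * U), cU U b * ∑ t ∈ Ioc 0 (y / b), h d (b * t)| +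
      |∑ m ∈ Ioc U y, gU U m * ∑ n ∈ Ioc U (y / m), vonMangoldt n * h d (m * n)| +
      |∑ k ∈ Ioc 0 y, vonMangoldt k * ((1 - ind k) * f d k)| := by
    intro d _
    rw [hsplit0 d, hV d, hT2split d, hT3 d, hIoc]
    have e : ∀ a b c c' e g : ℝ, a + b - (c + c') + e + g = a + b + (-c) + (-c') + e + g := by
      intros; ring
    rw [e]
    refine (abs_add_le _ _).trans (add_le_add ((abs_add_le _ _).trans (add_le_add
      ((abs_add_le _ _).trans (add_le_add ((abs_add_le _ _).trans (add_le_add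
      ((abs_add_le _ _).trans le_rfl) (by rw [abs_neg]))) (by rw [abs_neg]))) le_rfl)) le_rfl)
  refine (Finset.sum_le_sum hperd).trans ?_
  simp only [Finset.sum_add_distrib]
  simp only [hh, hind, hf] at hB0 hB1 hB2a hB2b hB3 hBNR ⊢
  have hlog0 : 0 ≤ Real.log x := Real.log_nonneg (by exact_mod_cast (show 1 ≤ x by omega))
  nlinarith [hB0, hB1, hB2a, hB2b, hB3, hBNR, Finset.sum_nonneg (fun d (_ : d ∈ Dset) =>
    abs_nonneg (∑ k ∈ Ioc 0 U, vonMangoldt k * ((if Nat.Coprime k P then (1:ℝ) else 0) *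
      (if d ∣ k + 2 then (liouville (k + 2) : ℝ) else 0))))]

end Summit.Parity.GeneralizedHardyLittlewood.Theorems
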